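import Literature.Computability.Cryptography.ChenQuantumLWEDatumPrivacy

/-!
# Joint datum privacy: measuring the registers of MANY runs does not read one run's `v′₀ mod Q` (T11)

REPRODUCTION / ANALYSIS OF A CLAIMED RESULT UNDER ADJUDICATION (withdrawn): Yilei Chen, *Quantum
Algorithms for Lattice Problems*, IACR ePrint 2024/555, version of 2024-04-18 [ChenQuantumLattice2024]
(the version carrying the author's note that Step 9 contains a bug), Step 9 (§3.5.9, pp. 34–38) acting
on `|φ8.b⟩ = Σ_{j ∈ ℤ_P} e(-j²/P) |2D²j·b + v′ mod N⟩` (p. 35), `P = p₁Q`, `N = D²P`; the algorithm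
repeats Steps 1–9 polynomially many times with the SAME LWE secret and a FRESH offset `v′` per run
(§3.6 p. 38).  Bundle `papers/QuantumAdvantage/lwe-quantum-autopsy/`, Part 2 (`REPAIR-CENSUS.md` §1
theorem **T11** and §18), on top of `ChenQuantumLWEDatumPrivacy.lean` (T10: one run) and
`ChenQuantumLWEClassTwirl.lean` (T4: the class twirl `twirledGram`).
HONEST FRAMING: kernel-checked THEOREMS about a state occurring in a WITHDRAWN algorithm — a precise
NEGATIVE result (an information ceiling for a whole class of repairs), NOT summit progress, no
cryptanalytic claim in either direction, no new algorithm; quantum lower bounds are out of scope.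

## The question

T10 (`datum_success_prob_le`): a secret-ignorant measurement of the Step-9 register of ONE run reads the
missing datum `a ∈ ℤ_Q` of that run (the residue of `v′₀ mod D²P` above Step 8's certificate
`v′₀ mod D²p₁`) with probability at most `1/Q + (1 − 1/Q)·π_B`.  The one modelling question it left on
the registers' side (its docstring, "What is NOT here"; Part 1's handoff item (σ″); `REPAIR-CENSUS.md` §6
item (4), last clause): the runs of the algorithm SHARE the secret, so could a JOINT — collective,
entangling, demolishing — measurement of the Step-9 registers of MANY runs read the datum of one of them
better, e.g. by first extracting something about the common secret from the other runs?

## The model and what is proved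

As in T10, fix `n, D, p₁, Q`, the unknown-coordinate set `U`, ANY integer instance `b`, a public `bk`
agreeing with `b` off `U`, and the offset `v′` of the run whose datum `a` is asked (run `0`).  The other
runs are indexed by an arbitrary finite type `κ` (any number of them); run `k` has its own, arbitrary
offset `w k`.  The class: ONE secret shift `s ∈ ℤ_Q^{n+1}` common to all runs (secret `b + 2p₁(s·𝟙_U)`,
`secretShift`), for run `0` the offset shift `c` (offset `v′ + d(a,c)`), and for every other run `k` its
own FRESH class data `e k = (a′_k, c′_k)` (offset `w k + d(a′_k, c′_k)`), all uniform.  The joint state of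
all registers (after `QFT^{⊗}`) is the product ket
`jointDatumKet a (s,c,e) (u, y) = datumKet a (s,c) u · Π_k siblingKet (w k) s (e k) (y k)` on the joint
Fourier basis `ℤ_N^{n+1} × (κ → ℤ_N^{n+1})` (run `0`'s register, then the others'); a joint measurement is
ANY `POVM` on that basis with outcomes in `ℤ_Q`, read as a guess of run `0`'s datum.  We prove, for all
parameters (no parity / coprimality unless stated):

* **`twirledGram_secretShift`**: the class twirl of T4 is invariant under the secret shifts —
  `ρ̄_{b+2p₁s𝟙_U, w} = ρ̄_{b, w}` entrywise (only `bk = b` off `U` is used; compare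
  `twirledGram_secret_indep`, which assumes `p₁ ∣ b_i` on `U`).  Hence (**`ketGram_siblingKet`**) the
  register of a sibling run, averaged over ITS OWN fresh class data, is the SAME operator `ρ̄_{b, w k}`
  for every secret of the class: a run whose datum is not in question carries no information about `s`.
* **`ketGram_jointDatumKet`**: the joint state given the datum factorises,
  `ρ^{joint}_a((u,y),(u′,y′)) = datumGram a (u,u′) · Π_k ρ̄_{b, w k}(y_k, y′_k)` — T10's matrix tensor a
  FIXED matrix.
* **`joint_datum_weight_le`** (T11): for EVERY joint POVM `E`, odd `P` (Cond. C.3),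
  `Σ_a Σ_{s,c,e} ⟨joint|E_a|joint⟩ ≤ C·(#generic + Q·#non-generic)` with the explicit constant
  `C = Q^{2(n+1)}P·(Q^{n+2}P)^{#κ}·N^{(n+1)#κ}` (T10's block lemma `POVM.sum_weight_le_of_blocks` on the
  block `{(u,y) : u generic}`); normalised by the total weight `Q·C·N^{n+1}`
  (**`joint_datum_totalWeight`**) this is **`joint_datum_success_prob_le`**:
  `Pr[guess = a] ≤ 1/Q + (1 − 1/Q)·π_B`, `π_B = #{u : no ū_i (i ∈ U) is a unit}/N^{n+1}` — EXACTLY T10's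
  bound, whatever the number of sibling runs; prime `Q`: `≤ 1/Q + (1 − 1/Q)/Q^{#U}`
  (**`joint_datum_success_prob_le_of_prime`**); worst case over the class
  (**`joint_datum_exists_member_le`**): every member has squared norm `(P·N^{n+1})^{#κ+1}`, so some member
  has correct-guess weight `≤ (1/Q + (1 − 1/Q)·π_B)·(P·N^{n+1})^{#κ+1}`.
* `Shape.joint_datum_privacy`, `Shape.joint_datum_privacy_of_prime` — the same for every admissible shape.

Reading (census T11 / rows G1, G2, §6 item (4)): supplying the Step-9 registers of any number of further
runs of the class to the measuring device does not raise the ceiling of T10 by anything: in the class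
model the fresh per-run offset data make each sibling register, as a quantum state, independent of the
secret AND of run `0`'s datum, so the joint state is `ρ_a ⊗ M` with `M` fixed, and an optimal joint
measurement can do no better than an optimal measurement of run `0` alone.  (A strategy that first
DETERMINES the secret from the runs' classical transcripts is Regev's regime — census §13, "circular" —
and outside this model, exactly as for T4/T10; the identification of the class data with all
secret-ignorant side information is census §0, by hand.)

## What is NOT here

Measurements placed BEFORE Step 8's partial measurement in any run ((R)'s setting, Part 1); guessing the
data of several runs at once (the success probability for a tuple is at most that of any one component, so
nothing new); sharpness (T10's remark applies verbatim with the siblings ignored); Steps 1–7.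

References: [ChenQuantumLattice2024] as above; [ZhangExactCoset2025] Y. Zhang, arXiv:2509.12341, p. 22
(AC4) and p. 5 (many samples); [NielsenChuang2010] §2.2.6 (POVMs), §2.4.1 (density operators of
ensembles), Box 2.3 (state discrimination).
-/

namespace Literature.Computability.Cryptography.Chen2024

open scoped BigOperators ComplexOrder
open Matrix

section JointDatum

variable (n : ℕ) (D p₁ Q : ℕ+)

/-! ### 1. A sibling run: its class-averaged register does not depend on the secret -/

/-- **The class twirl is invariant under the secret shifts of the class.**  For any `bk` agreeing with
`b` off `U`, every offset `w` and every `s ∈ ℤ_Q^{n+1}`: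
`ρ̄_{b + 2p₁(s·𝟙_U), w}(y,y′) = ρ̄_{b, w}(y,y′)`.  On the annihilator of the class the secret shift acts by
the phase `ψ_Q(−4σ·Σ_i s_i ȳ_i)` (`fourierGram_secretShift`) and the twirl factor forces `σ = 0`; off it
both sides vanish.  (T4's `twirledGram_secret_indep` is the same statement for two secrets `≡ 0 (mod p₁)`
on `U`; here no divisibility is assumed, the shift being the explicit `2p₁`-multiple of eq. (12).)
[cite: ChenQuantumLattice2024, §3.5.9 p. 35, eq. (12) p. 17] -/
theorem twirledGram_secretShift (U : Finset (Fin (n + 1))) (bk b w : Fin (n + 1) → ℤ)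
    (hbk : ∀ i, i ∉ U → bk i = b i) (s : Fin (n + 1) → ZQ Q) (y y' : Fin (n + 1) → ZN D p₁ Q) :
    twirledGram n D p₁ Q U bk (b + secretShift n p₁ Q U s) w y y'
      = twirledGram n D p₁ Q U bk b w y y' := by
  rw [twirledGram_eq, twirledGram_eq, twirlFactor_eq]
  by_cases hcoord : ∀ i ∈ U, classFreq n D p₁ Q U (y' - y) i = 0
  · by_cases hτ : toQ p₁ Q (lineFun n D p₁ Q bk (y' - y)) = 0
    · have hcoord' : ∀ i ∈ U, toQ p₁ Q (toP D (p₁ * Q) ((y' - y) i)) = 0 := fun i hi => by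
        have h := hcoord i hi
        unfold classFreq at h
        rwa [if_pos hi] at h
      have hσ : toQ p₁ Q (lineFun n D p₁ Q b (y' - y)) = 0 := by
        rw [toQ_lineFun_eq n D p₁ Q U b bk hbk (y' - y) hcoord', hτ]
      rw [fourierGram_secretShift n D p₁ Q U b w s y y' hcoord, hσ]
      simp only [mul_zero, zero_mul, neg_zero, AddChar.map_zero_eq_one, one_mul]
    · simp only [if_neg hτ, zero_mul]
  · push Not at hcoord
    obtain ⟨i, -, hne⟩ := hcoord
    rw [Finset.prod_eq_zero (Finset.mem_univ i) (if_neg hne)]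
    simp only [mul_zero, zero_mul]

/-- The Step-9 register (after `QFT`) of a SIBLING run of the class: the same secret `b + 2p₁(s·𝟙_U)`,
its own offset `w`, its own fresh class data `e = (a′, c′)` (offset `w + d(a′,c′)`).
[cite: ChenQuantumLattice2024, §3.5.9 p. 35, §3.6 p. 38] -/
noncomputable def siblingKet (U : Finset (Fin (n + 1))) (bk b w : Fin (n + 1) → ℤ)
    (s : Fin (n + 1) → ZQ Q) (e : ZQ Q × (Fin (n + 1) → ZQ Q)) : (Fin (n + 1) → ZN D p₁ Q) → ℂ :=
  qft (phi8bKet n D p₁ Q (b + secretShift n p₁ Q U s) (w + classShift n D p₁ Q U bk e.1 e.2))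

/-- **A sibling's averaged register is secret-independent.**  Averaged over its own class data `e`, the
Gram matrix of a sibling run is the class twirl `ρ̄_{b,w}` of T4 — the SAME matrix for every secret shift
`s`. [cite: ChenQuantumLattice2024, §3.5.9 p. 35; NielsenChuang2010, §2.4.1 p. 99] -/
theorem ketGram_siblingKet (U : Finset (Fin (n + 1))) (bk b w : Fin (n + 1) → ℤ)
    (hbk : ∀ i, i ∉ U → bk i = b i) (s : Fin (n + 1) → ZQ Q) (y y' : Fin (n + 1) → ZN D p₁ Q) :
    ketGram (siblingKet n D p₁ Q U bk b w s) y y' = twirledGram n D p₁ Q U bk b w y y' := by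
  rw [← twirledGram_secretShift n D p₁ Q U bk b w hbk s y y']
  unfold ketGram siblingKet twirledGram fourierGram
  rw [Fintype.sum_prod_type]

/-- The diagonal of a sibling's averaged register: `Q^{n+2}·P` (odd `P`: T3's flat weight `P` for each of
the `Q·Q^{n+1}` data). [cite: ChenQuantumLattice2024, §3.5.9 p. 35] -/
theorem ketGram_siblingKet_self (hP : Odd ((p₁ * Q : ℕ+) : ℕ)) (U : Finset (Fin (n + 1)))
    (bk b w : Fin (n + 1) → ℤ) (hbk : ∀ i, i ∉ U → bk i = b i) (s : Fin (n + 1) → ZQ Q)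
    (y : Fin (n + 1) → ZN D p₁ Q) :
    ketGram (siblingKet n D p₁ Q U bk b w s) y y
      = ((((Q : ℕ+) : ℕ) : ℂ)) ^ (n + 2) * ((((p₁ * Q : ℕ+) : ℕ) : ℂ)) := by
  rw [ketGram_siblingKet n D p₁ Q U bk b w hbk, twirledGram_self n D p₁ Q hP]

/-! ### 2. The joint state of run `0` and its siblings, given run `0`'s datum -/

variable {κ : Type*} [Fintype κ] [DecidableEq κ]

/-- The joint Step-9 registers of run `0` (datum `a`, offset shift `c`) and of the sibling runs `k : κ`
(fresh data `e k`), all with the common secret shift `s`: the product ket on the joint Fourier basis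
`ℤ_N^{n+1} × (κ → ℤ_N^{n+1})`, indexed by the class member `((s, c), e)`.
[cite: ChenQuantumLattice2024, §3.5.9 pp. 35–37, §3.6 p. 38] -/
noncomputable def jointDatumKet (U : Finset (Fin (n + 1))) (bk b v' : Fin (n + 1) → ℤ)
    (w : κ → Fin (n + 1) → ℤ) (a : ZQ Q)
    (i : ((Fin (n + 1) → ZQ Q) × (Fin (n + 1) → ZQ Q)) × (κ → ZQ Q × (Fin (n + 1) → ZQ Q))) :
    (Fin (n + 1) → ZN D p₁ Q) × (κ → (Fin (n + 1) → ZN D p₁ Q)) → ℂ :=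
  fun x => datumKet n D p₁ Q U bk b v' a i.1 x.1
    * ∏ k, siblingKet n D p₁ Q U bk b (w k) i.1.1 (i.2 k) (x.2 k)

/-- **Factorisation of the joint state given the datum**: `ρ^{joint}_a = datumGram a ⊗ (⊗_k ρ̄_{b, w k})`,
i.e. `ketGram (jointDatumKet a) ((u,y),(u′,y′)) = datumGram a (u,u′) · Π_k ρ̄_{b, w k}(y_k, y′_k)`: the
siblings' data average factorises run by run (independence) and each factor is secret-free
(`twirledGram_secretShift`), after which the common secret average is T10's.
[cite: ChenQuantumLattice2024, §3.5.9 pp. 35–37; NielsenChuang2010, §2.4.1 p. 99] -/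
theorem ketGram_jointDatumKet (U : Finset (Fin (n + 1))) (bk b v' : Fin (n + 1) → ℤ)
    (hbk : ∀ i, i ∉ U → bk i = b i) (w : κ → Fin (n + 1) → ℤ) (a : ZQ Q)
    (x x' : (Fin (n + 1) → ZN D p₁ Q) × (κ → (Fin (n + 1) → ZN D p₁ Q))) :
    ketGram (jointDatumKet n D p₁ Q U bk b v' w a) x x'
      = datumGram n D p₁ Q U bk b v' a x.1 x'.1
        * ∏ k, twirledGram n D p₁ Q U bk b (w k) (x.2 k) (x'.2 k) := by
  have hterm : ∀ (i₁ : (Fin (n + 1) → ZQ Q) × (Fin (n + 1) → ZQ Q))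
      (e : κ → ZQ Q × (Fin (n + 1) → ZQ Q)),
      jointDatumKet n D p₁ Q U bk b v' w a (i₁, e) x
          * (starRingEnd ℂ) (jointDatumKet n D p₁ Q U bk b v' w a (i₁, e) x')
        = (datumKet n D p₁ Q U bk b v' a i₁ x.1 * (starRingEnd ℂ) (datumKet n D p₁ Q U bk b v' a i₁ x'.1))
          * ∏ k, (siblingKet n D p₁ Q U bk b (w k) i₁.1 (e k) (x.2 k)
              * (starRingEnd ℂ) (siblingKet n D p₁ Q U bk b (w k) i₁.1 (e k) (x'.2 k))) := by
    intro i₁ e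
    unfold jointDatumKet
    rw [map_mul, map_prod, Finset.prod_mul_distrib]
    ring
  have hinner : ∀ i₁ : (Fin (n + 1) → ZQ Q) × (Fin (n + 1) → ZQ Q),
      ∑ e : κ → ZQ Q × (Fin (n + 1) → ZQ Q),
          ∏ k, (siblingKet n D p₁ Q U bk b (w k) i₁.1 (e k) (x.2 k)
            * (starRingEnd ℂ) (siblingKet n D p₁ Q U bk b (w k) i₁.1 (e k) (x'.2 k)))
        = ∏ k, twirledGram n D p₁ Q U bk b (w k) (x.2 k) (x'.2 k) := by
    intro i₁
    rw [(Fintype.prod_sum fun k (e' : ZQ Q × (Fin (n + 1) → ZQ Q)) =>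
        siblingKet n D p₁ Q U bk b (w k) i₁.1 e' (x.2 k)
          * (starRingEnd ℂ) (siblingKet n D p₁ Q U bk b (w k) i₁.1 e' (x'.2 k))).symm]
    refine Finset.prod_congr rfl fun k _ => ?_
    rw [← ketGram_siblingKet n D p₁ Q U bk b (w k) hbk i₁.1 (x.2 k) (x'.2 k)]
    rfl
  unfold ketGram
  rw [Fintype.sum_prod_type]
  simp_rw [hterm, ← Finset.mul_sum, hinner]
  rw [← Finset.sum_mul, ← ketGram_datumKet]
  rfl

/-- The diagonal of the joint state: `Q^{n+1}·Q^{n+1}·P · (Q^{n+2}·P)^{#κ}` for every outcome and every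
datum (odd `P`). [cite: ChenQuantumLattice2024, §3.5.9 p. 35] -/
theorem ketGram_jointDatumKet_self (hP : Odd ((p₁ * Q : ℕ+) : ℕ)) (U : Finset (Fin (n + 1)))
    (bk b v' : Fin (n + 1) → ℤ) (hbk : ∀ i, i ∉ U → bk i = b i) (w : κ → Fin (n + 1) → ℤ) (a : ZQ Q)
    (x : (Fin (n + 1) → ZN D p₁ Q) × (κ → (Fin (n + 1) → ZN D p₁ Q))) :
    ketGram (jointDatumKet n D p₁ Q U bk b v' w a) x x
      = ((((Q : ℕ+) : ℕ) : ℂ)) ^ (n + 1) * ((((Q : ℕ+) : ℕ) : ℂ)) ^ (n + 1) * ((((p₁ * Q : ℕ+) : ℕ) : ℂ))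
        * (((((Q : ℕ+) : ℕ) : ℂ)) ^ (n + 2) * ((((p₁ * Q : ℕ+) : ℕ) : ℂ))) ^ Fintype.card κ := by
  rw [ketGram_jointDatumKet n D p₁ Q U bk b v' hbk, datumGram_self n D p₁ Q hP]
  simp only [twirledGram_self n D p₁ Q hP, Finset.prod_const, Finset.card_univ]

/-! ### 3. T11: no joint measurement of the runs reads the datum of run `0` -/

/-- Every member of the joint class has squared norm `(P·N^{n+1})^{#κ+1}` (odd `P`: flat spectrum `P` on
each of the `N^{n+1}` outcomes, per run). [cite: ChenQuantumLattice2024, §3.5.9 p. 35] -/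
theorem jointDatumKet_normSq (hP : Odd ((p₁ * Q : ℕ+) : ℕ)) (U : Finset (Fin (n + 1)))
    (bk b v' : Fin (n + 1) → ℤ) (w : κ → Fin (n + 1) → ℤ) (a : ZQ Q)
    (i : ((Fin (n + 1) → ZQ Q) × (Fin (n + 1) → ZQ Q)) × (κ → ZQ Q × (Fin (n + 1) → ZQ Q))) :
    star (jointDatumKet n D p₁ Q U bk b v' w a i) ⬝ᵥ jointDatumKet n D p₁ Q U bk b v' w a i
      = (((((p₁ * Q : ℕ+) : ℕ) * ((D * D * (p₁ * Q) : ℕ+) : ℕ) ^ (n + 1)) ^ (Fintype.card κ + 1) : ℕ) : ℂ) := by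
  have h0 : ∀ u : Fin (n + 1) → ZN D p₁ Q,
      (starRingEnd ℂ) (datumKet n D p₁ Q U bk b v' a i.1 u) * datumKet n D p₁ Q U bk b v' a i.1 u
        = ((((p₁ * Q : ℕ+) : ℕ) : ℂ)) := fun u => by
    rw [mul_comm]
    exact fourierGram_self n D p₁ Q hP _ _ u
  have hk : ∀ k (y : Fin (n + 1) → ZN D p₁ Q),
      (starRingEnd ℂ) (siblingKet n D p₁ Q U bk b (w k) i.1.1 (i.2 k) y)
          * siblingKet n D p₁ Q U bk b (w k) i.1.1 (i.2 k) y
        = ((((p₁ * Q : ℕ+) : ℕ) : ℂ)) := fun k y => by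
    rw [mul_comm]
    exact fourierGram_self n D p₁ Q hP _ _ y
  have hterm : ∀ x : (Fin (n + 1) → ZN D p₁ Q) × (κ → (Fin (n + 1) → ZN D p₁ Q)),
      (starRingEnd ℂ) (jointDatumKet n D p₁ Q U bk b v' w a i x) * jointDatumKet n D p₁ Q U bk b v' w a i x
        = ((starRingEnd ℂ) (datumKet n D p₁ Q U bk b v' a i.1 x.1) * datumKet n D p₁ Q U bk b v' a i.1 x.1)
          * ∏ k, ((starRingEnd ℂ) (siblingKet n D p₁ Q U bk b (w k) i.1.1 (i.2 k) (x.2 k))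
              * siblingKet n D p₁ Q U bk b (w k) i.1.1 (i.2 k) (x.2 k)) := by
    intro x
    unfold jointDatumKet
    rw [map_mul, map_prod, Finset.prod_mul_distrib]
    ring
  simp only [dotProduct, Pi.star_apply, Complex.star_def]
  rw [Fintype.sum_prod_type]
  simp_rw [hterm, h0, hk, ← Finset.mul_sum]
  rw [(Fintype.prod_sum fun (_ : κ) (_ : Fin (n + 1) → ZN D p₁ Q) =>
      ((((p₁ * Q : ℕ+) : ℕ) : ℂ))).symm]
  simp only [Finset.sum_const, Finset.card_univ, Finset.prod_const, Fintype.card_fun, ZMod.card,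
    Fintype.card_fin, nsmul_eq_mul]
  push_cast
  ring

/-- **The total weight of the joint class**: `Σ_a Σ_{s,c,e} ‖jointDatumKet a (s,c,e)‖² = Q·C·N^{n+1}` with
`C = Q^{n+1}Q^{n+1}P·(Q^{n+2}P)^{#κ}·N^{(n+1)#κ}` (odd `P`).
[cite: ChenQuantumLattice2024, §3.5.9 p. 35] -/
theorem joint_datum_totalWeight (hP : Odd ((p₁ * Q : ℕ+) : ℕ)) (U : Finset (Fin (n + 1)))
    (bk b v' : Fin (n + 1) → ℤ) (w : κ → Fin (n + 1) → ℤ) :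
    ∑ a : ZQ Q, ∑ i, star (jointDatumKet n D p₁ Q U bk b v' w a i) ⬝ᵥ jointDatumKet n D p₁ Q U bk b v' w a i
      = ((((Q : ℕ+) : ℕ)
          * ((((Q : ℕ+) : ℕ) ^ (n + 1) * ((Q : ℕ+) : ℕ) ^ (n + 1) * ((p₁ * Q : ℕ+) : ℕ))
              * (((Q : ℕ+) : ℕ) ^ (n + 2) * ((p₁ * Q : ℕ+) : ℕ)) ^ Fintype.card κ
              * (((D * D * (p₁ * Q) : ℕ+) : ℕ) ^ (n + 1)) ^ Fintype.card κ)
          * ((D * D * (p₁ * Q) : ℕ+) : ℕ) ^ (n + 1) : ℕ) : ℂ) := by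
  simp only [jointDatumKet_normSq n D p₁ Q hP, Finset.sum_const, Finset.card_univ, Fintype.card_prod,
    Fintype.card_fun, ZMod.card, Fintype.card_fin, nsmul_eq_mul]
  push_cast
  ring

/-- The number of joint outcomes `(u, y)` with `u` in a given block is `#block · N^{(n+1)#κ}`. [folklore] -/
theorem card_filter_fst (G : (Fin (n + 1) → ZN D p₁ Q) → Prop) [DecidablePred G] :
    (Finset.univ.filter fun x : (Fin (n + 1) → ZN D p₁ Q) × (κ → (Fin (n + 1) → ZN D p₁ Q)) => G x.1).card
      = (Finset.univ.filter G).card * (((D * D * (p₁ * Q) : ℕ+) : ℕ) ^ (n + 1)) ^ Fintype.card κ := by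
  rw [← Finset.univ_product_univ, Finset.filter_product_left, Finset.card_product, Finset.card_univ,
    Fintype.card_fun, Fintype.card_fun, ZMod.card, Fintype.card_fin]

/-- **T11 (joint datum privacy, weight form).**  For EVERY POVM `E` on the JOINT Step-9 registers of run
`0` and of the sibling runs `κ`, with outcomes in `ℤ_Q` read as a guess of run `0`'s datum, if `P` is odd
(Cond. C.3) the total Born weight of a correct guess over the joint class is at most
`C·(#generic + Q·#non-generic)`, `C = Q^{n+1}Q^{n+1}P·(Q^{n+2}P)^{#κ}·N^{(n+1)#κ}`, the blocks being
those of run `0`'s outcome `u` alone (T10's `IsGeneric`): by the factorisation the joint state does not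
depend on the datum on `{u generic}` and has no coherence across the block boundary.
[cite: ChenQuantumLattice2024, §3.5.9 pp. 35–38; NielsenChuang2010, §2.2.6 p. 90] -/
theorem joint_datum_weight_le (hP : Odd ((p₁ * Q : ℕ+) : ℕ)) (U : Finset (Fin (n + 1)))
    (bk b v' : Fin (n + 1) → ℤ) (hbk : ∀ i, i ∉ U → bk i = b i) (w : κ → Fin (n + 1) → ℤ)
    (E : POVM ((Fin (n + 1) → ZN D p₁ Q) × (κ → (Fin (n + 1) → ZN D p₁ Q))) (ZQ Q)) :
    ∑ a, ∑ i, E.weight (jointDatumKet n D p₁ Q U bk b v' w a i) a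
      ≤ ((((((Q : ℕ+) : ℕ) ^ (n + 1) * ((Q : ℕ+) : ℕ) ^ (n + 1) * ((p₁ * Q : ℕ+) : ℕ))
            * (((Q : ℕ+) : ℕ) ^ (n + 2) * ((p₁ * Q : ℕ+) : ℕ)) ^ Fintype.card κ
            * (((D * D * (p₁ * Q) : ℕ+) : ℕ) ^ (n + 1)) ^ Fintype.card κ)
          * (Nat.card {u : Fin (n + 1) → ZN D p₁ Q // IsGeneric n D p₁ Q U u}
              + ((Q : ℕ+) : ℕ) * Nat.card {u : Fin (n + 1) → ZN D p₁ Q // ¬ IsGeneric n D p₁ Q U u}) : ℕ) : ℂ) := by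
  classical
  have h := E.sum_weight_le_of_blocks (jointDatumKet n D p₁ Q U bk b v' w)
    (fun x => IsGeneric n D p₁ Q U x.1) 0
    (fun a x x' hx _ => by
      rw [ketGram_jointDatumKet n D p₁ Q U bk b v' hbk, ketGram_jointDatumKet n D p₁ Q U bk b v' hbk,
        datumGram_indep n D p₁ Q U bk b v' hbk (isUnit_four_of_odd p₁ Q hP) hx a 0 x'.1])
    (fun a x x' hx hx' => by
      rw [ketGram_jointDatumKet n D p₁ Q U bk b v' hbk,
        datumGram_offBlock n D p₁ Q U bk b v' a (fun hiff => hx' (hiff.1 hx)), zero_mul])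
  refine h.trans (le_of_eq ?_)
  simp only [ketGram_jointDatumKet_self n D p₁ Q hP U bk b v' hbk, Finset.sum_const, Finset.card_univ,
    ZMod.card, nsmul_eq_mul, Nat.card_eq_fintype_card, Fintype.card_subtype]
  rw [card_filter_fst n D p₁ Q (IsGeneric n D p₁ Q U),
    card_filter_fst n D p₁ Q (fun u => ¬ IsGeneric n D p₁ Q U u)]
  push_cast
  ring

/-- **T11 (joint datum privacy, probability form).**  Normalising by the total weight of the joint class:
when run `0`'s datum `a`, the common secret shift `s`, run `0`'s offset shift `c` and every sibling's data
`e k` are uniform, EVERY joint measurement of all the Step-9 registers guesses `a` correctly with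
probability at most `1/Q + (1 − 1/Q)·π_B`, `π_B = #{non-generic u}/N^{n+1}` — the bound of T10
(`datum_success_prob_le`), unchanged by the siblings (`P` odd, Cond. C.3).
[cite: ChenQuantumLattice2024, §3.5.9 pp. 35–38, §3.6 p. 38; NielsenChuang2010, Box 2.3 p. 87] -/
theorem joint_datum_success_prob_le (hP : Odd ((p₁ * Q : ℕ+) : ℕ)) (U : Finset (Fin (n + 1)))
    (bk b v' : Fin (n + 1) → ℤ) (hbk : ∀ i, i ∉ U → bk i = b i) (w : κ → Fin (n + 1) → ℤ)
    (E : POVM ((Fin (n + 1) → ZN D p₁ Q) × (κ → (Fin (n + 1) → ZN D p₁ Q))) (ZQ Q)) :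
    (∑ a, ∑ i, E.weight (jointDatumKet n D p₁ Q U bk b v' w a i) a).re
        / (∑ a : ZQ Q, ∑ i,
            star (jointDatumKet n D p₁ Q U bk b v' w a i) ⬝ᵥ jointDatumKet n D p₁ Q U bk b v' w a i).re
      ≤ 1 / ((Q : ℕ+) : ℕ)
        + (1 - 1 / ((Q : ℕ+) : ℕ))
          * ((Nat.card {u : Fin (n + 1) → ZN D p₁ Q // ¬ IsGeneric n D p₁ Q U u} : ℝ)
              / (((D * D * (p₁ * Q) : ℕ+) : ℕ) : ℝ) ^ (n + 1)) := by
  classical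
  set K : ℕ := (((Q : ℕ+) : ℕ) ^ (n + 1) * ((Q : ℕ+) : ℕ) ^ (n + 1) * ((p₁ * Q : ℕ+) : ℕ))
            * (((Q : ℕ+) : ℕ) ^ (n + 2) * ((p₁ * Q : ℕ+) : ℕ)) ^ Fintype.card κ
            * (((D * D * (p₁ * Q) : ℕ+) : ℕ) ^ (n + 1)) ^ Fintype.card κ with hK
  set g : ℕ := Nat.card {u : Fin (n + 1) → ZN D p₁ Q // IsGeneric n D p₁ Q U u} with hg
  set m : ℕ := Nat.card {u : Fin (n + 1) → ZN D p₁ Q // ¬ IsGeneric n D p₁ Q U u} with hm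
  set Nn : ℕ := ((D * D * (p₁ * Q) : ℕ+) : ℕ) ^ (n + 1) with hNn
  have hgm : g + m = Nn := by
    rw [hg, hm, hNn, Nat.card_eq_fintype_card, Nat.card_eq_fintype_card, Fintype.card_subtype_compl,
      add_tsub_cancel_of_le (Fintype.card_subtype_le _), Fintype.card_fun, ZMod.card, Fintype.card_fin]
  have hKpos : (0 : ℝ) < K := by
    rw [hK]
    positivity
  have hQpos : (0 : ℝ) < ((Q : ℕ+) : ℕ) := by exact_mod_cast PNat.pos Q
  have hNpos : (0 : ℝ) < Nn := by
    rw [hNn]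
    positivity
  have hnum : (∑ a, ∑ i, E.weight (jointDatumKet n D p₁ Q U bk b v' w a i) a).re
      ≤ ((K * (g + ((Q : ℕ+) : ℕ) * m) : ℕ) : ℝ) := by
    have h := (Complex.le_def.1 (joint_datum_weight_le n D p₁ Q hP U bk b v' hbk w E)).1
    rwa [Complex.natCast_re] at h
  have hden : (∑ a : ZQ Q, ∑ i, star (jointDatumKet n D p₁ Q U bk b v' w a i)
      ⬝ᵥ jointDatumKet n D p₁ Q U bk b v' w a i).re = ((((Q : ℕ+) : ℕ) * K * Nn : ℕ) : ℝ) := by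
    rw [joint_datum_totalWeight n D p₁ Q hP, Complex.natCast_re]
  rw [hden]
  have hg' : (g : ℝ) = (Nn : ℝ) - m := by
    rw [← hgm]
    push_cast
    ring
  have hNn' : (Nn : ℝ) = (((D * D * (p₁ * Q) : ℕ+) : ℕ) : ℝ) ^ (n + 1) := by
    rw [hNn, Nat.cast_pow]
  calc (∑ a, ∑ i, E.weight (jointDatumKet n D p₁ Q U bk b v' w a i) a).re
          / ((((Q : ℕ+) : ℕ) * K * Nn : ℕ) : ℝ)
      ≤ ((K * (g + ((Q : ℕ+) : ℕ) * m) : ℕ) : ℝ) / ((((Q : ℕ+) : ℕ) * K * Nn : ℕ) : ℝ) :=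
        div_le_div_of_nonneg_right hnum (by positivity)
    _ = 1 / ((Q : ℕ+) : ℕ) + (1 - 1 / ((Q : ℕ+) : ℕ)) * ((m : ℝ) / (Nn : ℝ)) := by
        push_cast
        rw [hg']
        field_simp
        ring
    _ = 1 / ((Q : ℕ+) : ℕ)
        + (1 - 1 / ((Q : ℕ+) : ℕ))
          * ((m : ℝ) / (((D * D * (p₁ * Q) : ℕ+) : ℕ) : ℝ) ^ (n + 1)) := by rw [hNn']

/-- **T11, worst case over the joint class.**  Every member has squared norm `(P·N^{n+1})^{#κ+1}`, so for
EVERY joint POVM some member `(a, ((s,c), e))` has correct-guess weight at most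
`(1/Q + (1 − 1/Q)·π_B)·(P·N^{n+1})^{#κ+1}`: no joint measurement beats T10's bound on every instance.
[cite: ChenQuantumLattice2024, §3.5.9 pp. 35–38] -/
theorem joint_datum_exists_member_le (hP : Odd ((p₁ * Q : ℕ+) : ℕ)) (U : Finset (Fin (n + 1)))
    (bk b v' : Fin (n + 1) → ℤ) (hbk : ∀ i, i ∉ U → bk i = b i) (w : κ → Fin (n + 1) → ℤ)
    (E : POVM ((Fin (n + 1) → ZN D p₁ Q) × (κ → (Fin (n + 1) → ZN D p₁ Q))) (ZQ Q)) :
    ∃ a : ZQ Q, ∃ i : ((Fin (n + 1) → ZQ Q) × (Fin (n + 1) → ZQ Q)) × (κ → ZQ Q × (Fin (n + 1) → ZQ Q)),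
      (E.weight (jointDatumKet n D p₁ Q U bk b v' w a i) a).re
        ≤ (1 / ((Q : ℕ+) : ℕ)
              + (1 - 1 / ((Q : ℕ+) : ℕ))
                * ((Nat.card {u : Fin (n + 1) → ZN D p₁ Q // ¬ IsGeneric n D p₁ Q U u} : ℝ)
                    / (((D * D * (p₁ * Q) : ℕ+) : ℕ) : ℝ) ^ (n + 1)))
          * (((((p₁ * Q : ℕ+) : ℕ) * ((D * D * (p₁ * Q) : ℕ+) : ℕ) ^ (n + 1)) ^ (Fintype.card κ + 1) : ℕ) : ℝ) := by
  classical
  obtain ⟨β, hβ⟩ : ∃ β : ℝ, β = 1 / ((Q : ℕ+) : ℕ)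
      + (1 - 1 / ((Q : ℕ+) : ℕ))
        * ((Nat.card {u : Fin (n + 1) → ZN D p₁ Q // ¬ IsGeneric n D p₁ Q U u} : ℝ)
            / (((D * D * (p₁ * Q) : ℕ+) : ℕ) : ℝ) ^ (n + 1)) := ⟨_, rfl⟩
  obtain ⟨W, hW⟩ : ∃ W : ℝ,
      W = (((((p₁ * Q : ℕ+) : ℕ) * ((D * D * (p₁ * Q) : ℕ+) : ℕ) ^ (n + 1)) ^ (Fintype.card κ + 1) : ℕ) : ℝ) :=
    ⟨_, rfl⟩
  rw [← hβ, ← hW]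
  have htot : (∑ a : ZQ Q, ∑ i, star (jointDatumKet n D p₁ Q U bk b v' w a i)
      ⬝ᵥ jointDatumKet n D p₁ Q U bk b v' w a i).re
        = (Fintype.card (ZQ Q × (((Fin (n + 1) → ZQ Q) × (Fin (n + 1) → ZQ Q))
            × (κ → ZQ Q × (Fin (n + 1) → ZQ Q)))) : ℝ) * W := by
    rw [Complex.re_sum]
    simp_rw [Complex.re_sum, jointDatumKet_normSq n D p₁ Q hP, Complex.natCast_re]
    rw [hW]
    simp only [Finset.sum_const, Finset.card_univ, Fintype.card_prod]
    push_cast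
    ring
  have hWpos : 0 < W := by
    rw [hW]
    positivity
  have hpos : 0 < (∑ a : ZQ Q, ∑ i, star (jointDatumKet n D p₁ Q U bk b v' w a i)
      ⬝ᵥ jointDatumKet n D p₁ Q U bk b v' w a i).re := by
    rw [htot]
    positivity
  have h := joint_datum_success_prob_le n D p₁ Q hP U bk b v' hbk w E
  rw [← hβ, div_le_iff₀ hpos, htot] at h
  have hsum : (∑ a, ∑ i, E.weight (jointDatumKet n D p₁ Q U bk b v' w a i) a).re
      = ∑ p : ZQ Q × (((Fin (n + 1) → ZQ Q) × (Fin (n + 1) → ZQ Q))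
            × (κ → ZQ Q × (Fin (n + 1) → ZQ Q))),
          (E.weight (jointDatumKet n D p₁ Q U bk b v' w p.1 p.2) p.1).re := by
    rw [Complex.re_sum, Fintype.sum_prod_type]
    simp only [Complex.re_sum]
  rw [hsum] at h
  have h' : ∑ p : ZQ Q × (((Fin (n + 1) → ZQ Q) × (Fin (n + 1) → ZQ Q))
            × (κ → ZQ Q × (Fin (n + 1) → ZQ Q))),
        (E.weight (jointDatumKet n D p₁ Q U bk b v' w p.1 p.2) p.1).re
      ≤ ∑ _p : ZQ Q × (((Fin (n + 1) → ZQ Q) × (Fin (n + 1) → ZQ Q))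
            × (κ → ZQ Q × (Fin (n + 1) → ZQ Q))), β * W := by
    refine h.trans (le_of_eq ?_)
    rw [Finset.sum_const, Finset.card_univ, nsmul_eq_mul]
    ring
  obtain ⟨p, -, hp⟩ := Finset.exists_le_of_sum_le Finset.univ_nonempty h'
  exact ⟨p.1, p.2, hp⟩

/-- **T11 for prime `Q`**: every joint measurement of all the runs' Step-9 registers guesses run `0`'s
datum with probability at most `1/Q + (1 − 1/Q)/Q^m`, `m = #U` the number of unknown coordinates (odd
`P`) — T10's prime-`Q` bound, unchanged by the siblings.
[cite: ChenQuantumLattice2024, §3.5.9 pp. 35–38; NielsenChuang2010, Box 2.3 p. 87] -/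
theorem joint_datum_success_prob_le_of_prime [Fact (Nat.Prime ((Q : ℕ+) : ℕ))]
    (hP : Odd ((p₁ * Q : ℕ+) : ℕ)) (U : Finset (Fin (n + 1))) (bk b v' : Fin (n + 1) → ℤ)
    (hbk : ∀ i, i ∉ U → bk i = b i) (w : κ → Fin (n + 1) → ℤ)
    (E : POVM ((Fin (n + 1) → ZN D p₁ Q) × (κ → (Fin (n + 1) → ZN D p₁ Q))) (ZQ Q)) :
    (∑ a, ∑ i, E.weight (jointDatumKet n D p₁ Q U bk b v' w a i) a).re
        / (∑ a : ZQ Q, ∑ i,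
            star (jointDatumKet n D p₁ Q U bk b v' w a i) ⬝ᵥ jointDatumKet n D p₁ Q U bk b v' w a i).re
      ≤ 1 / ((Q : ℕ+) : ℕ) + (1 - 1 / ((Q : ℕ+) : ℕ)) / (((Q : ℕ+) : ℕ) : ℝ) ^ U.card := by
  have h := joint_datum_success_prob_le n D p₁ Q hP U bk b v' hbk w E
  have hc := card_nonGeneric_mul_of_prime n D p₁ Q U
  have hfrac : (Nat.card {u : Fin (n + 1) → ZN D p₁ Q // ¬ IsGeneric n D p₁ Q U u} : ℝ)
      / (((D * D * (p₁ * Q) : ℕ+) : ℕ) : ℝ) ^ (n + 1) = 1 / (((Q : ℕ+) : ℕ) : ℝ) ^ U.card := by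
    rw [div_eq_div_iff (by positivity) (by positivity), one_mul, ← Nat.cast_pow, ← Nat.cast_pow,
      ← Nat.cast_mul, hc]
  rwa [hfrac, mul_one_div] at h

end JointDatum

end Literature.Computability.Cryptography.Chen2024

/-! ### 4. The `Steps` rendering: T11 for every admissible shape -/

namespace Literature.Computability.Cryptography.Chen2024.Shape

open scoped BigOperators ComplexOrder
open Matrix

variable (S : Shape) {κ : Type*} [Fintype κ] [DecidableEq κ]

/-- **T11 for every admissible shape.**  Let `U` be any set of coordinates (the unknown ones), `bk` any
public vector agreeing with `S.b` off `U`, `v′` the offset of the run in question, `w k` (`k : κ`, any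
finite index type) the offsets of the sibling runs, and `E` ANY joint measurement (POVM) of all the
Step-9 registers with outcomes in `ℤ_Q`.  With the datum `a`, the common secret shift `s`, the offset
shift `c` and the siblings' data uniform, `E` outputs `a` with probability at most
`1/Q + (1 − 1/Q)·π_B` (C.3 makes `P` odd) — the single-run bound `Shape.datum_privacy`.
[cite: ChenQuantumLattice2024, §3.5.9 pp. 35–38, §3.6 p. 38, Cond. C.3 p. 18, eq. (12) p. 17] -/
theorem joint_datum_privacy (h : S.Admissible) (U : Finset (Fin (S.n + 1))) (bk : Fin (S.n + 1) → ℤ)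
    (hbk : ∀ i, i ∉ U → bk i = S.b i) (v' : Fin (S.n + 1) → ℤ) (w : κ → Fin (S.n + 1) → ℤ)
    (E : POVM ((Fin (S.n + 1) → ZN S.D S.p₁ S.Q) × (κ → (Fin (S.n + 1) → ZN S.D S.p₁ S.Q))) (ZQ S.Q)) :
    (∑ a, ∑ i, E.weight (jointDatumKet S.n S.D S.p₁ S.Q U bk S.b v' w a i) a).re
        / (∑ a : ZQ S.Q, ∑ i, star (jointDatumKet S.n S.D S.p₁ S.Q U bk S.b v' w a i)
            ⬝ᵥ jointDatumKet S.n S.D S.p₁ S.Q U bk S.b v' w a i).re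
      ≤ 1 / (S.Q : ℕ)
        + (1 - 1 / (S.Q : ℕ))
          * ((Nat.card {u : Fin (S.n + 1) → ZN S.D S.p₁ S.Q // ¬ IsGeneric S.n S.D S.p₁ S.Q U u} : ℝ)
              / ((S.N : ℕ) : ℝ) ^ (S.n + 1)) :=
  joint_datum_success_prob_le S.n S.D S.p₁ S.Q h.odd_P U bk S.b v' hbk w E

/-- **T11 for every admissible shape with `Q` prime** (`κ = 2` in Chen's parameters): the bound is
`1/Q + (1 − 1/Q)/Q^{#U}`, however many sibling runs are measured jointly.
[cite: ChenQuantumLattice2024, §3.5.9 pp. 35–38, §3.6 p. 38, Cond. C.3 p. 18] -/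
theorem joint_datum_privacy_of_prime (h : S.Admissible) [Fact (Nat.Prime (S.Q : ℕ))]
    (U : Finset (Fin (S.n + 1))) (bk : Fin (S.n + 1) → ℤ) (hbk : ∀ i, i ∉ U → bk i = S.b i)
    (v' : Fin (S.n + 1) → ℤ) (w : κ → Fin (S.n + 1) → ℤ)
    (E : POVM ((Fin (S.n + 1) → ZN S.D S.p₁ S.Q) × (κ → (Fin (S.n + 1) → ZN S.D S.p₁ S.Q))) (ZQ S.Q)) :
    (∑ a, ∑ i, E.weight (jointDatumKet S.n S.D S.p₁ S.Q U bk S.b v' w a i) a).re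
        / (∑ a : ZQ S.Q, ∑ i, star (jointDatumKet S.n S.D S.p₁ S.Q U bk S.b v' w a i)
            ⬝ᵥ jointDatumKet S.n S.D S.p₁ S.Q U bk S.b v' w a i).re
      ≤ 1 / (S.Q : ℕ) + (1 - 1 / (S.Q : ℕ)) / ((S.Q : ℕ) : ℝ) ^ U.card :=
  joint_datum_success_prob_le_of_prime S.n S.D S.p₁ S.Q h.odd_P U bk S.b v' hbk w E

end Literature.Computability.Cryptography.Chen2024.Shape
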